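import Mathlib
import HarnessLib.Audit.Tags

/-!
# The potential `Φ₀` for the two-linked-systems inequality (RES0′) with free `g` and free `h`

Model (sunflower-partition relaxation, prove-1 g52 §0): parameters `τ, σ, s ∈ (0,1)`, floors
`0 < α₀₀ ≤ α₀₁ ≤ α₁₁ ≤ 1`, `p = τ(1−σ)`, `q = s(1−τ)`, faces `Ȳ_j = (1−s) y_j + s k_j`, `H_j = (1−σ) g_j + σ h_j` with
floors `b_Ȳ = (1−s)α₀₀ + sα₀₁`, `b_H = (1−σ)α₀₁ + σα₁₁`, `g = c₀ + p b_Ȳ + q b_H`, petal value `G_j = c₀ + p Ȳ_j + q H_j`,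
petals `α₀₀ ≤ y_j ≤ k_j ≤ 1`, `α₀₁ ≤ g_j ≤ min(k_j, h_j)`, `α₁₁ ≤ h_j ≤ 1`, leaf-leaf constant
`τσ + (1−s)(1−τ)α₀₀ ≤ c₀ ≤ τσ + (1−s)(1−τ)α₀₁`.

`Φ₀` (prove-1 gen 54, memo FINDING-FREEH-prove1-g54 §7(g)(vii)) is the budget-FREE potential
`g·Φ₀ = c₀ + p b_Ȳ X + max( q(1−σ)α₀₁·max(K, R·α₁₁/α₀₁) + qσα₁₁ R ,  q b_H Y )`,
`X = ∏ Ȳ_j/b_Ȳ`, `K = ∏ k_j/α₀₁`, `R = ∏ h_j/α₁₁`, `Y = ∏ H_j/b_H` (face and cell USAGES of the family).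
`Phi0Conj` states `∏ G_j ≤ g^(n−1)·(g Φ₀)` for every family obeying only the per-petal constraints (no violation is known:
random, structured and adversarial searches of gen 54); `res0_of_phi0Conj` is the kernel-checked reduction: `Phi0Conj` implies
(RES0′) — `∏ G_j ≤ g^(n−1)(c₀ + p + q)` — for EVERY number of petals from the four budgets `∏ Ȳ_j ≤ b_Ȳ^(n−1)`,
`∏ k_j ≤ α₀₁^(n−1)`, `∏ h_j ≤ α₁₁^(n−1)`, `∏ H_j ≤ b_H^(n−1)` (Ȳ-face, k-cell, h-cell, H-face).  [this work]
-/

namespace Summit.CriticalPhenomena.PercolationContinuityZ3.Theorems.SunflowerPartition.SafeCalc.LinkedCurrency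

open Finset

/-- The numerator `g·Φ₀` of the potential `Φ₀` of a family of `n` petals (see the module docstring). [this work] -/
noncomputable def phi0Num (τ σ s α01 α11 c0 bY bH : ℝ) (n : ℕ) (Yb kc hc Hf : Fin n → ℝ) : ℝ :=
  c0 + τ * (1 - σ) * bY * ((∏ j, Yb j) / bY ^ n) +
    max (s * (1 - τ) * (1 - σ) * α01 * max ((∏ j, kc j) / α01 ^ n) ((∏ j, hc j) / α11 ^ n * (α11 / α01)) +
          s * (1 - τ) * σ * α11 * ((∏ j, hc j) / α11 ^ n))
        (s * (1 - τ) * bH * ((∏ j, Hf j) / bH ^ n))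

/-- **CONJECTURE Φ₀** (prove-1 gen 54; OPEN — no proof and no counterexample known; it implies (RES0′) for all `n`,
`res0_of_phi0Conj`).  For every `n ≥ 1` and every family of petals obeying only the per-petal constraints,
`∏_j G_j ≤ g^(n−1) · (g Φ₀)`.  Evidence: memo FINDING-FREEH-prove1-g54 §7(g)(vii),(ix) (150k random, 160k structured,
adversarial families; the `n = 2` case reduces to a max-free polynomial inequality verified on 300k pairs). [this work] -/
@[conjecture] def Phi0Conj : Prop :=
  ∀ (n : ℕ) (τ σ s α00 α01 α11 c0 : ℝ) (y k gc h : Fin n → ℝ),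
    0 < n → 0 < τ → τ < 1 → 0 < σ → σ < 1 → 0 < s → s < 1 →
    0 < α00 → α00 ≤ α01 → α01 ≤ α11 → α11 ≤ 1 →
    τ * σ + (1 - s) * (1 - τ) * α00 ≤ c0 → c0 ≤ τ * σ + (1 - s) * (1 - τ) * α01 →
    (∀ j, α00 ≤ y j) → (∀ j, y j ≤ k j) → (∀ j, k j ≤ 1) →
    (∀ j, α01 ≤ gc j) → (∀ j, gc j ≤ k j) → (∀ j, gc j ≤ h j) → (∀ j, α11 ≤ h j) → (∀ j, h j ≤ 1) →
    ∏ j, (c0 + τ * (1 - σ) * ((1 - s) * y j + s * k j) + s * (1 - τ) * ((1 - σ) * gc j + σ * h j)) ≤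
      (c0 + τ * (1 - σ) * ((1 - s) * α00 + s * α01) + s * (1 - τ) * ((1 - σ) * α01 + σ * α11)) ^ (n - 1) *
        phi0Num τ σ s α01 α11 c0 ((1 - s) * α00 + s * α01) ((1 - σ) * α01 + σ * α11) n
          (fun j => (1 - s) * y j + s * k j) k h (fun j => (1 - σ) * gc j + σ * h j)

/-- **The budget step**: under the four budgets `∏ Ȳ_j ≤ b_Ȳ^(n−1)`, `∏ k_j ≤ α₀₁^(n−1)`, `∏ h_j ≤ α₁₁^(n−1)`,
`∏ H_j ≤ b_H^(n−1)` (and positive floors, `τ, σ < 1`, `s, τ' ≥ 0`), the numerator `g Φ₀` is at most the full value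
`a = c₀ + p + q`.  Uses only `X ≤ 1/b_Ȳ`, `K ≤ 1/α₀₁`, `R·α₁₁/α₀₁ ≤ 1/α₀₁`, `Y ≤ 1/b_H`. [this work] -/
theorem phi0Num_le_of_budgets {τ σ s α01 α11 c0 bY bH : ℝ} {n : ℕ} (hn : 0 < n)
    (hτ0 : 0 ≤ τ) (hτ1 : τ ≤ 1) (hσ0 : 0 ≤ σ) (hσ1 : σ ≤ 1) (hs0 : 0 ≤ s)
    (hα01 : 0 < α01) (hα11 : 0 < α11) (hbY : 0 < bY) (hbH : 0 < bH)
    (Yb kc hc Hf : Fin n → ℝ)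
    (hBY : ∏ j, Yb j ≤ bY ^ (n - 1)) (hBk : ∏ j, kc j ≤ α01 ^ (n - 1))
    (hBh : ∏ j, hc j ≤ α11 ^ (n - 1)) (hBH : ∏ j, Hf j ≤ bH ^ (n - 1)) :
    phi0Num τ σ s α01 α11 c0 bY bH n Yb kc hc Hf ≤ c0 + τ * (1 - σ) + s * (1 - τ) := by
  unfold phi0Num
  -- usage bounds: U ≤ floor^(n-1)  ⟹  U / floor^n ≤ 1/floor
  have hpow : ∀ {b : ℝ}, 0 < b → ∀ {U : ℝ}, U ≤ b ^ (n - 1) → U / b ^ n ≤ 1 / b := by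
    intro b hb U hU
    rw [div_le_div_iff₀ (pow_pos hb n) hb]
    have : b ^ n = b ^ (n - 1) * b := by
      rw [← pow_succ]; congr 1; omega
    rw [this]; nlinarith
  have hX := hpow hbY hBY
  have hK := hpow hα01 hBk
  have hR := hpow hα11 hBh
  have hY := hpow hbH hBH
  have hp0 : 0 ≤ τ * (1 - σ) := mul_nonneg hτ0 (sub_nonneg.2 hσ1)
  have hq0 : 0 ≤ s * (1 - τ) := mul_nonneg hs0 (sub_nonneg.2 hτ1)
  -- Ȳ-term
  have h1 : τ * (1 - σ) * bY * ((∏ j, Yb j) / bY ^ n) ≤ τ * (1 - σ) := by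
    have := mul_le_mul_of_nonneg_left hX (mul_nonneg hp0 hbY.le)
    calc τ * (1 - σ) * bY * ((∏ j, Yb j) / bY ^ n) ≤ τ * (1 - σ) * bY * (1 / bY) := this
      _ = τ * (1 - σ) := by field_simp
  -- inner max ≤ 1/α01
  have hRk : (∏ j, hc j) / α11 ^ n * (α11 / α01) ≤ 1 / α01 := by
    have := mul_le_mul_of_nonneg_right hR (div_nonneg hα11.le hα01.le)
    calc (∏ j, hc j) / α11 ^ n * (α11 / α01) ≤ 1 / α11 * (α11 / α01) := this
      _ = 1 / α01 := by field_simp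
  have hM : max ((∏ j, kc j) / α01 ^ n) ((∏ j, hc j) / α11 ^ n * (α11 / α01)) ≤ 1 / α01 := max_le hK hRk
  have h2 : s * (1 - τ) * (1 - σ) * α01 * max ((∏ j, kc j) / α01 ^ n) ((∏ j, hc j) / α11 ^ n * (α11 / α01)) +
      s * (1 - τ) * σ * α11 * ((∏ j, hc j) / α11 ^ n) ≤ s * (1 - τ) := by
    have e1 := mul_le_mul_of_nonneg_left hM (mul_nonneg (mul_nonneg hq0 (sub_nonneg.2 hσ1)) hα01.le)
    have e2 := mul_le_mul_of_nonneg_left hR (mul_nonneg (mul_nonneg hq0 hσ0) hα11.le)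
    have f1 : s * (1 - τ) * (1 - σ) * α01 * (1 / α01) = s * (1 - τ) * (1 - σ) := by field_simp
    have f2 : s * (1 - τ) * σ * α11 * (1 / α11) = s * (1 - τ) * σ := by field_simp
    nlinarith
  have h3 : s * (1 - τ) * bH * ((∏ j, Hf j) / bH ^ n) ≤ s * (1 - τ) := by
    have := mul_le_mul_of_nonneg_left hY (mul_nonneg hq0 hbH.le)
    calc s * (1 - τ) * bH * ((∏ j, Hf j) / bH ^ n) ≤ s * (1 - τ) * bH * (1 / bH) := this
      _ = s * (1 - τ) := by field_simp
  have h4 := max_le h2 h3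
  linarith

/-- **REDUCTION: CONJECTURE Φ₀ ⟹ (RES0′) for every number of petals, from the four budgets (BȲ), (Bk), (Bh), (BH).**
If `Phi0Conj` holds then for every `n ≥ 1`, all model parameters, every leaf-leaf constant
`τσ + (1−s)(1−τ)α₀₀ ≤ c₀ ≤ τσ + (1−s)(1−τ)α₀₁` and every family of petals obeying the per-petal constraints and the four
product budgets, `∏_j G_j ≤ g^(n−1) · (c₀ + p + q)`. [this work] -/
theorem res0_of_phi0Conj (hΦ : Phi0Conj) (n : ℕ) (τ σ s α00 α01 α11 c0 : ℝ) (y k gc h : Fin n → ℝ)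
    (hn : 0 < n) (hτ0 : 0 < τ) (hτ1 : τ < 1) (hσ0 : 0 < σ) (hσ1 : σ < 1) (hs0 : 0 < s) (hs1 : s < 1)
    (hα00 : 0 < α00) (h01 : α00 ≤ α01) (h11 : α01 ≤ α11) (hα1 : α11 ≤ 1)
    (hc0l : τ * σ + (1 - s) * (1 - τ) * α00 ≤ c0) (hc0u : c0 ≤ τ * σ + (1 - s) * (1 - τ) * α01)
    (hy : ∀ j, α00 ≤ y j) (hyk : ∀ j, y j ≤ k j) (hk1 : ∀ j, k j ≤ 1)
    (hg : ∀ j, α01 ≤ gc j) (hgk : ∀ j, gc j ≤ k j) (hgh : ∀ j, gc j ≤ h j) (hh : ∀ j, α11 ≤ h j) (hh1 : ∀ j, h j ≤ 1)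
    (hBY : ∏ j, ((1 - s) * y j + s * k j) ≤ ((1 - s) * α00 + s * α01) ^ (n - 1))
    (hBk : ∏ j, k j ≤ α01 ^ (n - 1)) (hBh : ∏ j, h j ≤ α11 ^ (n - 1))
    (hBH : ∏ j, ((1 - σ) * gc j + σ * h j) ≤ ((1 - σ) * α01 + σ * α11) ^ (n - 1)) :
    ∏ j, (c0 + τ * (1 - σ) * ((1 - s) * y j + s * k j) + s * (1 - τ) * ((1 - σ) * gc j + σ * h j)) ≤
      (c0 + τ * (1 - σ) * ((1 - s) * α00 + s * α01) + s * (1 - τ) * ((1 - σ) * α01 + σ * α11)) ^ (n - 1) *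
        (c0 + τ * (1 - σ) + s * (1 - τ)) := by
  have hα01 : 0 < α01 := lt_of_lt_of_le hα00 h01
  have hα11 : 0 < α11 := lt_of_lt_of_le hα01 h11
  have hbY : 0 < (1 - s) * α00 + s * α01 := by
    nlinarith [mul_pos (sub_pos.2 hs1) hα00, mul_pos hs0 hα01]
  have hbH : 0 < (1 - σ) * α01 + σ * α11 := by
    nlinarith [mul_pos (sub_pos.2 hσ1) hα01, mul_pos hσ0 hα11]
  have hmain := hΦ n τ σ s α00 α01 α11 c0 y k gc h hn hτ0 hτ1 hσ0 hσ1 hs0 hs1 hα00 h01 h11 hα1 hc0l hc0u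
    hy hyk hk1 hg hgk hgh hh hh1
  have hbud := phi0Num_le_of_budgets (c0 := c0) hn hτ0.le hτ1.le hσ0.le hσ1.le hs0.le hα01 hα11 hbY hbH
    (fun j => (1 - s) * y j + s * k j) k h (fun j => (1 - σ) * gc j + σ * h j) hBY hBk hBh hBH
  have hgpos : 0 ≤ (c0 + τ * (1 - σ) * ((1 - s) * α00 + s * α01) +
      s * (1 - τ) * ((1 - σ) * α01 + σ * α11)) ^ (n - 1) := by
    apply pow_nonneg
    have hc0nn : 0 ≤ τ * σ + (1 - s) * (1 - τ) * α00 := by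
      have h1 := mul_nonneg hτ0.le hσ0.le
      have h2 := mul_nonneg (mul_nonneg (sub_nonneg.2 hs1.le) (sub_nonneg.2 hτ1.le)) hα00.le
      linarith
    have : 0 ≤ c0 := le_trans hc0nn hc0l
    nlinarith [mul_nonneg (mul_nonneg hτ0.le (sub_nonneg.2 hσ1.le)) hbY.le,
      mul_nonneg (mul_nonneg hs0.le (sub_nonneg.2 hτ1.le)) hbH.le]
  exact hmain.trans (mul_le_mul_of_nonneg_left hbud hgpos)

/-- **`Phi0Conj` IS FALSE** (prove-1 gen 55).  Explicit counterexample with `n = 5`: two Ȳ-petals `(y,k,g,h) = (1,1,α₀₁,α₁₁)` and three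
`h`-petals `(α₀₀,α₀₁,α₀₁,1)` at `τ = σ = 1/500`, `s = 1/2`, `α₀₀ = α₀₁ = 10⁻⁶`, `α₁₁ = 10⁻³`, `c₀ = τσ + (1−s)(1−τ)α₀₀`:
`∏ G_j / (g⁴·gΦ₀) ≈ 6.24`.  Mechanism: the cross term (Ȳ-cloud value)×(h-cloud value) is multiplicative in the two clouds, while Φ₀ (and every
potential additive in the usages `X, K, R, Y`, e.g. Φ*) pays it from one cloud's credit; the family is budget-infeasible, so (RES0′) is untouched and
`res0_of_phi0Conj` is vacuous — the budgets are essential for `n ≥ 5` (memo FINDING-PHI0-prove1-g55 §1). [this work] -/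
theorem not_phi0Conj' : ¬ Phi0Conj := by
  intro hΦ
  have h := hΦ 5 (1/500) (1/500) (1/2) (1/10^6) (1/10^6) (1/1000) (4499/1000000000)
    ![1, 1, 1/10^6, 1/10^6, 1/10^6] ![1, 1, 1/10^6, 1/10^6, 1/10^6]
    ![1/10^6, 1/10^6, 1/10^6, 1/10^6, 1/10^6] ![1/1000, 1/1000, 1, 1, 1]
    (by norm_num) (by norm_num) (by norm_num) (by norm_num) (by norm_num) (by norm_num) (by norm_num)
    (by norm_num) (by norm_num) (by norm_num) (by norm_num) (by norm_num) (by norm_num)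
    (fun j => by fin_cases j <;> simp <;> norm_num) (fun j => by fin_cases j <;> simp)
    (fun j => by fin_cases j <;> simp <;> norm_num) (fun j => by fin_cases j <;> simp)
    (fun j => by fin_cases j <;> simp <;> norm_num) (fun j => by fin_cases j <;> simp <;> norm_num)
    (fun j => by fin_cases j <;> simp <;> norm_num) (fun j => by fin_cases j <;> simp <;> norm_num)
  simp only [phi0Num, Fin.prod_univ_five, Matrix.cons_val_zero, Matrix.cons_val_one, Matrix.head_cons,
    Matrix.cons_val_two, Matrix.cons_val_three, Matrix.cons_val_four, Matrix.tail_cons] at h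
  norm_num [max_def] at h

end Summit.CriticalPhenomena.PercolationContinuityZ3.Theorems.SunflowerPartition.SafeCalc.LinkedCurrency
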